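import Summits.HodgeConjecture.HodgeConjecture.Theorems.MarkmanPartnerTransportPicardThreeK3SquaresKugaSatakeBiquadratic

/-!
# Route MarkmanPartnerTransport · crux `PicardThreeK3Squares` (stmt-HodgeConjecture-19652) —
# the cycle-induced transcendental endomorphisms of a projective K3 surface form a (non-unital) `ℚ`-ALGEBRA:
# closure under products, rational multiples, positive powers, polynomials without constant term; agreement on `T(S)`

Bookkeeping for the programme «VARESCO-SELF WITHOUT DEFORMATION» (prover hodge-nonav-19652-p1 gen 9) and for every
Kuga–Satake-conditional cell of the crux: the predicate `IsCycleInducedTranscendentalEndomorphism S hS t`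
(`t` rational, type-preserving, killing `N¹(S)`, image cup-orthogonal to `N¹(S)`, `t = [γ]_*` for an algebraic
`γ ∈ A²(S × S)`) is closed under

* `0` (`…_zero`), sums (`…KugaSatakeBiquadratic.isCycleInducedTranscendentalEndomorphism_add`, earlier file),
  products `t₁ ∘ t₂ = [γ₁ ∘ γ₂]_*` (`…_mul`: composition of algebraic correspondences between surfaces,
  `corrComp_surfaces_of_cup`, Fulton Prop. 16.1.1, `N² ∪ N² ⊆ N⁴` by
  `SquareOfGenerator.cupProduct_mem_algebraicClasses_tripleProduct`), rational multiples (`…_smul`), positive powers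
  (`…_pow_succ`) and rational polynomials without constant term (`…_aeval_mul_X`);
* and an endomorphism (rational, type-preserving, killing `N¹`, image `⊥ N¹`) agreeing ON `T(S)` with a cycle-induced
  one is cycle-induced (`isCycleInduced_of_eq_on_transcendental`, algebraic transcendental projector via
  `QuotientSimilitude.exists_corr_eq_of_eq_on_transcendental`).

All unconditional; no definition, no sorry; nothing here proves HC. `--supports stmt-HodgeConjecture-19652`.

References: W. Fulton, *Intersection Theory* §16.1 Prop. 16.1.1; B. van Geemen, M. Schütt, arXiv:2310.05196 §4.8;
M. Varesco, Math. Z. 305 (2023) §2.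
-/

set_option linter.dupNamespace false

noncomputable section

namespace Summit.HodgeConjecture.HodgeConjecture.Theorems.MarkmanPartnerTransport.KugaSatakeSimilitude

open Module CategoryTheory MonoidalCategory CartesianMonoidalCategory Polynomial
open Literature.AlgebraicGeometry Literature.AlgebraicGeometry.Motives Literature.AlgebraicGeometry.HodgeTheory
open Literature.AlgebraicGeometry.Surfaces
open Literature.AlgebraicTopology.SingularHomology
open Summit.HodgeConjecture.HodgeConjecture.Theorems
open Summit.HodgeConjecture.HodgeConjecture.Theorems.MarkmanPartnerTransport

variable {S : SchemeOver ℂ}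

/-- `Transc[S, y]`: `y` is cup-orthogonal to `N¹(S)`. Local notation only. -/
local notation3 (prettyPrint := false) "Transc[" S ", " y "]" =>
  (∀ d ∈ algebraicClasses S 1, cupProduct (rfl : 2 * 1 + 2 * 1 = 2 * 2) y d = 0)

/-- `Corr[μ, hS ; γ, y] = fst_*(snd^* y ∪ γ)` on `H²(S(ℂ); ℂ)` (`hS : IsSmoothProjective 2 S`). Local notation only. -/
local notation3 (prettyPrint := false) "Corr[" μ ", " hS " ; " γ ", " y "]" =>
  complexGysin μ (IsSmoothProjective.tensor_holds hS hS) hS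
    (SemiCartesianMonoidalCategory.fst _ _) (rfl : 2 * 1 + 2 * 2 + 2 * 2 = 2 * 1 + 2 * (2 + 2))
    (cupProduct (rfl : 2 * 1 + 2 * 2 = 2 * 1 + 2 * 2)
      (complexBetti.map (SemiCartesianMonoidalCategory.snd _ _) (2 * 1) y) γ)

/-! ### Cycle-induced transcendental endomorphisms: closure under products, rational multiples, polynomials -/

/-- `0 = [0]_*` is a cycle-induced transcendental endomorphism. [cite: Fulton1998, §16.1 Prop. 16.1.1] -/
theorem isCycleInducedTranscendentalEndomorphism_zero (hS : IsK3Surface S) :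
    IsCycleInducedTranscendentalEndomorphism S hS.isSmoothProjective 0 := by
  refine ⟨fun y _ => ?_, fun i j y hy => ?_, fun d _ => rfl, fun y d _ => ?_,
    0, Submodule.zero_mem _, fun y => ?_⟩
  · rw [LinearMap.zero_apply]; exact IsRationalClass.zero
  · obtain ⟨A, -⟩ := hy
    rw [LinearMap.zero_apply]; exact IsOfHodgeType.zero A _ _ _
  · rw [LinearMap.zero_apply, LinearMap.map_zero₂]
  · rw [LinearMap.zero_apply, OneCycle.corr_eq_corrAction, map_zero, LinearMap.zero_apply]

/-- **Products of cycle-induced transcendental endomorphisms are cycle-induced**: `[γ₁]_* ∘ [γ₂]_* = [γ₁ ∘ γ₂]_*`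
by the composition of algebraic correspondences between surfaces (`corrComp_surfaces_of_cup`, Fulton
Prop. 16.1.1, with `N² ∪ N² ⊆ N⁴` from `SquareOfGenerator.cupProduct_mem_algebraicClasses_tripleProduct`); the four
linear clauses compose. Unconditional. [cite: Fulton1998, §16.1 Prop. 16.1.1] [cite: GeemenSchutt2023, §4.8] -/
theorem isCycleInducedTranscendentalEndomorphism_mul (hS : IsK3Surface S)
    {t₁ t₂ : complexBetti S (2 * 1) →ₗ[ℂ] complexBetti S (2 * 1)}
    (h₁ : IsCycleInducedTranscendentalEndomorphism S hS.isSmoothProjective t₁)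
    (h₂ : IsCycleInducedTranscendentalEndomorphism S hS.isSmoothProjective t₂) :
    IsCycleInducedTranscendentalEndomorphism S hS.isSmoothProjective (t₁ * t₂) := by
  obtain ⟨h1rat, h1typ, -, h1perp, γ₁, hγ₁, hγ₁t⟩ := h₁
  obtain ⟨h2rat, h2typ, h2N, -, γ₂, hγ₂, hγ₂t⟩ := h₂
  obtain ⟨γ, hγ, hγt⟩ := corrComp_surfaces_of_cup complexOrientationFamily
    SquareOfGenerator.cupProduct_mem_algebraicClasses_tripleProduct S S S hS.isSmoothProjective
    hS.isSmoothProjective hS.isSmoothProjective γ₁ hγ₁ γ₂ hγ₂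
  refine ⟨fun y hy => ?_, fun i j y hy => ?_, fun d hd => ?_, fun y d hd => ?_, γ, hγ, fun y => ?_⟩
  · rw [Module.End.mul_apply]; exact h1rat _ (h2rat y hy)
  · rw [Module.End.mul_apply]; exact h1typ i j _ (h2typ i j y hy)
  · rw [Module.End.mul_apply, h2N d hd, map_zero]
  · rw [Module.End.mul_apply]; exact h1perp _ d hd
  · rw [Module.End.mul_apply, hγ₂t y, hγ₁t, hγt y]

/-- **Rational multiples of cycle-induced transcendental endomorphisms are cycle-induced**: `q · [γ]_* = [q · γ]_*`.
Unconditional. [cite: Fulton1998, §16.1 Prop. 16.1.1] [cite: VoisinHodgeI2002, §11.1.2 Prop. 11.20] -/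
theorem isCycleInducedTranscendentalEndomorphism_smul (hS : IsK3Surface S) (q : ℚ)
    {t : complexBetti S (2 * 1) →ₗ[ℂ] complexBetti S (2 * 1)}
    (h : IsCycleInducedTranscendentalEndomorphism S hS.isSmoothProjective t) :
    IsCycleInducedTranscendentalEndomorphism S hS.isSmoothProjective ((q : ℂ) • t) := by
  obtain ⟨hrat, htyp, hN, hperp, γ, hγ, hγt⟩ := h
  refine ⟨fun y hy => ?_, fun i j y hy => ?_, fun d hd => ?_, fun y d hd => ?_,
    (q : ℂ) • γ, Submodule.smul_mem _ _ hγ, fun y => ?_⟩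
  · rw [LinearMap.smul_apply]; exact (hrat y hy).smul q
  · rw [LinearMap.smul_apply]; exact (htyp i j y hy).smul _
  · rw [LinearMap.smul_apply, hN d hd, smul_zero]
  · rw [LinearMap.smul_apply, LinearMap.map_smul₂, hperp y d hd, smul_zero]
  · rw [LinearMap.smul_apply, hγt y, OneCycle.corr_eq_corrAction, OneCycle.corr_eq_corrAction, map_smul,
      LinearMap.smul_apply]

/-- Positive powers of a cycle-induced transcendental endomorphism are cycle-induced. [cite: Fulton1998, §16.1 Prop. 16.1.1] -/
theorem isCycleInducedTranscendentalEndomorphism_pow_succ (hS : IsK3Surface S)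
    {t : complexBetti S (2 * 1) →ₗ[ℂ] complexBetti S (2 * 1)}
    (h : IsCycleInducedTranscendentalEndomorphism S hS.isSmoothProjective t) (n : ℕ) :
    IsCycleInducedTranscendentalEndomorphism S hS.isSmoothProjective (t ^ (n + 1)) := by
  induction n with
  | zero => rwa [zero_add, pow_one]
  | succ n ih =>
    rw [pow_succ]
    exact isCycleInducedTranscendentalEndomorphism_mul hS ih h

/-- **Rational polynomials WITHOUT constant term in a cycle-induced transcendental endomorphism are
cycle-induced**: `(R · X)(t) = Σ rᵢ tⁱ⁺¹`. Unconditional. [cite: Fulton1998, §16.1 Prop. 16.1.1] [cite: GeemenSchutt2023, §4.8] -/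
theorem isCycleInducedTranscendentalEndomorphism_aeval_mul_X (hS : IsK3Surface S)
    {t : complexBetti S (2 * 1) →ₗ[ℂ] complexBetti S (2 * 1)}
    (h : IsCycleInducedTranscendentalEndomorphism S hS.isSmoothProjective t) (R : ℚ[X]) :
    IsCycleInducedTranscendentalEndomorphism S hS.isSmoothProjective
      (Polynomial.aeval t ((R * X).map (algebraMap ℚ ℂ))) := by
  induction R using Polynomial.induction_on' with
  | add R₁ R₂ h₁ h₂ =>
    rw [add_mul, Polynomial.map_add, map_add]
    exact isCycleInducedTranscendentalEndomorphism_add hS h₁ h₂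
  | monomial n a =>
    rw [Polynomial.monomial_mul_X, Polynomial.map_monomial, Polynomial.aeval_monomial, ← Algebra.smul_def,
      eq_ratCast]
    exact isCycleInducedTranscendentalEndomorphism_smul hS a
      (isCycleInducedTranscendentalEndomorphism_pow_succ hS h n)

/-- **Agreement on `T(S)` suffices**: an endomorphism `ψ` of `H²(S(ℂ); ℂ)` (rational, type-preserving,
killing `N¹(S)`, image cup-orthogonal to `N¹(S)`) that agrees on the transcendental classes with a
cycle-induced one is itself cycle-induced (compose with the algebraic transcendental projector,
`QuotientSimilitude.exists_corr_eq_of_eq_on_transcendental`; `H² = N¹ + T`). Unconditional.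
[cite: Varesco2023, §2 (p. 8)] [cite: Fulton1998, §16.1 Prop. 16.1.1] -/
theorem isCycleInduced_of_eq_on_transcendental (hS : IsK3Surface S)
    (ψ g : complexBetti S (2 * 1) →ₗ[ℂ] complexBetti S (2 * 1))
    (h1 : ∀ y, IsRationalClass y → IsRationalClass (ψ y))
    (h2 : ∀ (i j : ℕ) y, IsOfHodgeType 2 S (2 * 1) i j y → IsOfHodgeType 2 S (2 * 1) i j (ψ y))
    (h3 : ∀ d ∈ algebraicClasses S 1, ψ d = 0)
    (h4 : ∀ y : complexBetti S (2 * 1), Transc[S, ψ y])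
    (hg : IsCycleInducedTranscendentalEndomorphism S hS.isSmoothProjective g)
    (heq : ∀ y : complexBetti S (2 * 1), Transc[S, y] → ψ y = g y) :
    IsCycleInducedTranscendentalEndomorphism S hS.isSmoothProjective ψ := by
  obtain ⟨-, -, -, -, γ, hγ, hγg⟩ := hg
  have hγψ : ∀ y ∈ transcendentalSubspace S,
      Corr[complexOrientationFamily, hS.isSmoothProjective ; γ, y] = ψ y := fun y hy => by
    rw [← hγg y]
    exact (heq y ((mem_transcendentalSubspace_iff_forall_algebraicClasses hS.isSmoothProjective y).1 hy)).symm
  obtain ⟨γ', hγ', hγ'ψ⟩ := QuotientSimilitude.exists_corr_eq_of_eq_on_transcendental hS hS ψ h3 hγ hγψ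
  exact ⟨h1, h2, h3, h4, γ', hγ', fun y => (hγ'ψ y).symm⟩

end Summit.HodgeConjecture.HodgeConjecture.Theorems.MarkmanPartnerTransport.KugaSatakeSimilitude

end
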